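import Mathlib
import HarnessLib
import Summits.ResolutionOfSingularities.ResolutionOfSingularities.Theorems.HomologicalConductorPersistenceLossAr
import Summits.ResolutionOfSingularities.ResolutionOfSingularities.Theorems.HomologicalConductorPersistenceLatticeDivisibility

/-!
# Crux `Persistence` (stmt-ResolutionOfSingularities-16484), chain W4.4b — (ζ) part 2:
# THE BRIDGE `coker (z̄•1 − N̄) ≅ (A^k, N₀)` AND «NO CERTIFICATE FOR `z^a t^{c₀}`»

Route `ResolutionOfSingularities/HomologicalConductor`.  OURS (cell res-hironaka, crux chain W4.4b,
planner res-L1-w44b-plan-1 CUTS 2026-08-27 «(ζ) = the bridge + R4-LOST-ALL-r assembly», seat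
res-D-pv-026); nothing here is a statement of the manuscript under review (Hironaka 2017); AI-written,
weaker than expert review.  Continues `…PersistenceLossAr` (part 1: the generic Knörrer double
`φ_N = z•1 − N`, `ψ_N = Σ_{j ≤ r} z^{r−j} N^j`, `φ_N ψ_N = ψ_N φ_N = z^{r+1}•1` for `N^{r+1} = 0`).

SETTING.  `A` a commutative ring, `T_r := A[z] ⧸ (z^{r+1})` (`Tr A r`, `red` the reduction), `N₀` a
`k × k` matrix over `A` read in `A[z]` as `N = N₀.map C`, and
`CokerN r N₀ := T_r^k ⧸ im (φ̄_N)` — LITERALLY the module res-D-pv-058's U7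
(`stablyAnnihilates_coker_of_eq`, `…PersistenceStableAnnihilatorMF`) speaks about for `f = z^{r+1}`.

* §2 `shiftMatrix S k = J_k` (upper shift), its powers, nilpotency `J_k^m = 0 (m ≥ k)`, columns.
* §3 **THE BRIDGE ((ζ)(i))**: the comparison map `Λ = toCokerN : A^k → CokerN r N₀`, `a ↦ [a]`, is
  `A`-linear with `z̄ • Λ a = Λ (N₀ a)` (`red_X_smul_toCokerN`), SURJECTIVE (the constants generate:
  `z̄^n [e_i] ∈ im Λ` by `z̄`-stability) and, when `N₀^{r+1} = 0`, INJECTIVE (`[a] = 0 ⇒ a = φ̄ w ⇒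
  ψ̄ a = z̄^{r+1} w = 0`, and the `z^r`-coefficient of `(ψ_N a)_i` is `a_i`); whence the `A`-linear
  isomorphism `toCokerNEquiv` and the lattice basis `cokerBasis` (`[e_i]`, with `z̄ [e_i] = Λ(N₀ e_i)`).
* §4 **NO CERTIFICATE ((ζ)(ii))**: for `N₀ = t^γ J_k` over a domain `A`, `t ≠ 0` a non-unit,
  `k ≤ r + 1`, `a < k`, `γ a + c₀ < γ r`: `z^a t^{c₀}` does not stably annihilate `CokerN`
  (res-D-pv-058's U14 `not_stablyAnnihilates_of_basis_of_lt` on `cokerBasis`, with the power basis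
  `pbTr` = Mathlib's `AdjoinRoot.powerBasis'` read on the quotient), hence
  `(z^a t^{c₀}) • 1 = G ψ_N + φ_N E` has no solution over `A[z]` (U7a).

The assembly over `K[x,y,z,t] ⧸ (xy − z^{r+1})` through res-type-010's Knörrer transfer (U13) is the
sibling file `…PersistenceLossArLost`.  All elementary module theory; [folklore]/OURS.
-/

noncomputable section

-- single-problem summit: the doubled namespace component `ResolutionOfSingularities` is forced
set_option linter.dupNamespace false

open Matrix Polynomial
open Literature.RingTheory.CohomologyAnnihilator
open Summit.ResolutionOfSingularities.ResolutionOfSingularities.Theorems.NoZeno.SandwichCluster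
open Summit.ResolutionOfSingularities.ResolutionOfSingularities.Theorems.HomologicalConductor.PersistenceStableAnnihilatorMF
open Summit.ResolutionOfSingularities.ResolutionOfSingularities.Theorems.HomologicalConductor.PersistenceLatticeDivisibility

universe u

namespace Summit.ResolutionOfSingularities.ResolutionOfSingularities.Theorems.HomologicalConductor.LossAr

/-! ## §2 The shift matrix `J_k` -/

section Shift

variable {S : Type u} [CommRing S]

/-- The upper shift matrix `J_k` (`(J_k)_{i,i+1} = 1`, else `0`): on column vectors `J_k e₀ = 0`,
`J_k e_{i+1} = e_i`. [OURS · L1 w44b] -/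
def shiftMatrix (S : Type u) [CommRing S] (k : ℕ) : Matrix (Fin k) (Fin k) S :=
  Matrix.of fun i j => if (j : ℕ) = (i : ℕ) + 1 then 1 else 0

/-- Entries of `J_k`. [folklore] -/
theorem shiftMatrix_apply (k : ℕ) (i j : Fin k) :
    shiftMatrix S k i j = if (j : ℕ) = (i : ℕ) + 1 then 1 else 0 := rfl

/-- Powers of the shift: `(J_k^m)_{i,j} = [j = i + m]`. [folklore] -/
theorem shiftMatrix_pow_apply (k m : ℕ) (i j : Fin k) :
    (shiftMatrix S k ^ m) i j = if (j : ℕ) = (i : ℕ) + m then 1 else 0 := by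
  induction m generalizing i j with
  | zero => simp [Matrix.one_apply, Fin.ext_iff, eq_comm]
  | succ m ih =>
    rw [pow_succ, Matrix.mul_apply]
    simp_rw [ih, shiftMatrix_apply, ite_mul, one_mul, zero_mul]
    by_cases h : (i : ℕ) + m < k
    · rw [Finset.sum_eq_single ⟨(i : ℕ) + m, h⟩]
      · simp only [if_true]
        by_cases hj : (j : ℕ) = (i : ℕ) + (m + 1)
        · rw [if_pos hj, if_pos (by simp [hj]; ring)]
        · rw [if_neg hj, if_neg (by simpa [add_assoc] using hj)]
      · intro l _ hl
        rw [if_neg (fun e => hl (Fin.ext e))]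
      · simp
    · rw [Finset.sum_eq_zero (fun l _ => ?_), if_neg (by have := j.2; omega)]
      rw [if_neg (by have := l.2; omega)]

/-- `J_k^m = 0` for `m ≥ k`. [folklore] -/
theorem shiftMatrix_pow_eq_zero (k m : ℕ) (hm : k ≤ m) :
    shiftMatrix S k ^ m = 0 := by
  ext i j
  rw [shiftMatrix_pow_apply, Matrix.zero_apply, if_neg (by have := j.2; omega)]

/-- `(s • J_k)^m = 0` for `m ≥ k`. [folklore] -/
theorem smul_shiftMatrix_pow_eq_zero (s : S) (k m : ℕ) (hm : k ≤ m) :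
    (s • shiftMatrix S k) ^ m = 0 := by
  rw [_root_.smul_pow, shiftMatrix_pow_eq_zero k m hm, smul_zero]

/-- Column `0` of `s • J_k` vanishes: `(s • J_k) e₀ = 0`. [folklore] -/
theorem smul_shiftMatrix_mulVec_single_zero (s : S) {k : ℕ} (h : 0 < k) :
    (s • shiftMatrix S k) *ᵥ Pi.single (⟨0, h⟩ : Fin k) 1 = 0 := by
  ext i
  simp [shiftMatrix_apply]

/-- Column `i + 1` of `s • J_k` is `s e_i`: `(s • J_k) e_{i+1} = s • e_i`. [folklore] -/
theorem smul_shiftMatrix_mulVec_single_succ (s : S) {k : ℕ} (i : ℕ) (h : i + 1 < k) :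
    (s • shiftMatrix S k) *ᵥ Pi.single (⟨i + 1, h⟩ : Fin k) 1 =
      s • Pi.single (⟨i, by omega⟩ : Fin k) 1 := by
  ext l
  simp only [Matrix.mulVec_single_one, Matrix.col_apply, Matrix.smul_apply, shiftMatrix_apply,
    Pi.smul_apply, Pi.single_apply, Fin.ext_iff, smul_eq_mul, mul_ite, mul_one, mul_zero]
  by_cases hl : (l : ℕ) = i
  · rw [if_pos (by omega), if_pos hl]
  · rw [if_neg (by omega), if_neg hl]

end Shift

/-! ## §3 THE BRIDGE: `coker (z̄•1 − N̄)` over `T_r = A[z]/(z^{r+1})` is the lattice `(A^k, N₀)` -/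

section Bridge

variable {A : Type u} [CommRing A] (r : ℕ) {k : ℕ} (N₀ : Matrix (Fin k) (Fin k) A)

/-- `T_r := A[z] ⧸ (z^{r+1})` (written as the quotient U7/U13 speak about). [OURS · L1 w44b] -/
abbrev Tr (A : Type u) [CommRing A] (r : ℕ) : Type u :=
  A[X] ⧸ Ideal.span ({(X : A[X]) ^ (r + 1)} : Set A[X])

/-- The reduction `A[z] → T_r`. [OURS · L1 w44b] -/
abbrev red (A : Type u) [CommRing A] (r : ℕ) : A[X] →+* Tr A r :=
  Ideal.Quotient.mk (Ideal.span ({(X : A[X]) ^ (r + 1)} : Set A[X]))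

/-- The MF-module `coker (φ̄_N : T_r^k → T_r^k)`, `φ_N = z•1 − N`, `N = N₀` read in `A[z]` — literally
the module of U7 (`stablyAnnihilates_coker_of_eq`) for `f = z^{r+1}`, `φ = φ_N`. [OURS · L1 w44b] -/
abbrev CokerN (r : ℕ) (N₀ : Matrix (Fin k) (Fin k) A) : Type u :=
  (Fin k → Tr A r) ⧸
    LinearMap.range ((phiN (X : A[X]) (N₀.map C)).map (red A r)).mulVecLin

/-- The comparison map `Λ : A^k → coker φ̄_N`, `a ↦ [a]` (constants). [OURS · L1 w44b] -/
def toCokerN : (Fin k → A) →ₗ[A] CokerN r N₀ :=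
  (LinearMap.range ((phiN (X : A[X]) (N₀.map C)).map (red A r)).mulVecLin).mkQ.restrictScalars A ∘ₗ
    (Algebra.linearMap A (Tr A r)).compLeft (Fin k)

/-- `Λ a = [ι a]`, `ι = algebraMap` entrywise. [OURS · L1 w44b] -/
theorem toCokerN_apply (a : Fin k → A) :
    toCokerN r N₀ a = Submodule.Quotient.mk (fun i => algebraMap A (Tr A r) (a i)) := rfl

/-- The reduction of a constant is the structure map. [folklore] -/
theorem red_C (x : A) : red A r (C x) = algebraMap A (Tr A r) x := by
  show red A r (algebraMap A A[X] x) = _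
  exact Ideal.Quotient.mk_algebraMap A (Ideal.span ({(X : A[X]) ^ (r + 1)} : Set A[X])) x

/-- `N̄ = N₀` read in `T_r` through the structure map. [folklore] -/
theorem map_map_red : (N₀.map C).map (red A r) = N₀.map (algebraMap A (Tr A r)) := by
  rw [Matrix.map_map]
  exact congrArg N₀.map (funext (red_C r))

/-- `φ̄_N v = z̄ • v − N̄ v`. [OURS · L1 w44b] -/
theorem phiN_map_red_mulVec (v : Fin k → Tr A r) :
    ((phiN (X : A[X]) (N₀.map C)).map (red A r)) *ᵥ v =
      red A r X • v - (N₀.map (algebraMap A (Tr A r))) *ᵥ v := by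
  rw [phiN, Matrix.map_sub _ (fun _ _ => map_sub (red A r) _ _), map_mk_smul_one, map_map_red,
    Matrix.sub_mulVec, Matrix.smul_mulVec, Matrix.one_mulVec]

/-- `(s t) • m = s • (t • m)` on `coker φ̄_N` (the `mul_smul` instance path, pinned). [folklore] -/
theorem mul_smul_cokerN (s t : Tr A r) (m : CokerN r N₀) : (s * t) • m = s • t • m :=
  mul_smul s t m

/-- `(algebraMap c) • m = c • m` on `coker φ̄_N` (pinned instance path). [folklore] -/
theorem algebraMap_smul_cokerN (c : A) (m : CokerN r N₀) : algebraMap A (Tr A r) c • m = c • m :=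
  algebraMap_smul (Tr A r) c m

/-- `[s • v] = s • [v]` on `coker φ̄_N` (pinned instance path). [folklore] -/
theorem mk_smul_cokerN (s : Tr A r) (v : Fin k → Tr A r) :
    (Submodule.Quotient.mk (s • v) : CokerN r N₀) = s • Submodule.Quotient.mk v :=
  Submodule.Quotient.mk_smul _ s v

/-- **`z̄` acts on constants as `N₀`**: `z̄ • Λ a = Λ (N₀ a)`. [OURS · L1 w44b] -/
theorem red_X_smul_toCokerN (a : Fin k → A) :
    red A r X • toCokerN r N₀ a = toCokerN r N₀ (N₀ *ᵥ a) := by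
  rw [toCokerN_apply, toCokerN_apply, ← mk_smul_cokerN, Submodule.Quotient.eq]
  refine ⟨fun i => algebraMap A (Tr A r) (a i), ?_⟩
  rw [Matrix.mulVecLin_apply, phiN_map_red_mulVec]
  congr 1
  funext i
  exact (RingHom.map_mulVec (algebraMap A (Tr A r)) N₀ a i).symm

/-- The range of `Λ` is stable under `z̄`. [OURS · L1 w44b] -/
theorem red_X_smul_mem_range {m : CokerN r N₀} (hm : m ∈ LinearMap.range (toCokerN r N₀)) :
    red A r X • m ∈ LinearMap.range (toCokerN r N₀) := by
  obtain ⟨a, rfl⟩ := hm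
  exact ⟨N₀ *ᵥ a, (red_X_smul_toCokerN r N₀ a).symm⟩

/-- … hence under every scalar of `T_r`. [OURS · L1 w44b] -/
theorem smul_mem_range (s : Tr A r) {m : CokerN r N₀} (hm : m ∈ LinearMap.range (toCokerN r N₀)) :
    s • m ∈ LinearMap.range (toCokerN r N₀) := by
  obtain ⟨p, rfl⟩ := Ideal.Quotient.mk_surjective s
  induction p using Polynomial.induction_on' with
  | add p q hp hq =>
    rw [map_add, add_smul]
    exact Submodule.add_mem _ hp hq
  | monomial n c =>
    rw [← C_mul_X_pow_eq_monomial, map_mul, map_pow, red_C, mul_smul_cokerN, algebraMap_smul_cokerN]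
    refine Submodule.smul_mem _ c ?_
    induction n with
    | zero => rwa [pow_zero, one_smul]
    | succ n ih =>
      rw [pow_succ' (red A r X) n, mul_smul_cokerN]
      exact red_X_smul_mem_range r N₀ ih

/-- `Λ (e_i) = [e_i]`. [OURS · L1 w44b] -/
theorem toCokerN_single (i : Fin k) :
    toCokerN r N₀ (Pi.single i 1) = Submodule.Quotient.mk (Pi.single i 1) := by
  rw [toCokerN_apply]
  congr 1
  funext j
  rw [Pi.apply_single (fun _ => algebraMap A (Tr A r)) (fun _ => map_zero _), map_one]

/-- **`Λ` is surjective**: `coker φ̄_N` is generated over `A` by the constants. [OURS · L1 w44b] -/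
theorem toCokerN_surjective : Function.Surjective (toCokerN r N₀) := by
  suffices h : ∀ v : Fin k → Tr A r, Submodule.Quotient.mk v ∈ LinearMap.range (toCokerN r N₀) by
    intro m
    obtain ⟨v, rfl⟩ := Submodule.Quotient.mk_surjective _ m
    exact LinearMap.mem_range.mp (h v)
  intro v
  have hsingle : ∀ i, (Pi.single i (v i) : Fin k → Tr A r) = v i • Pi.single i 1 := fun i => by
    ext j
    by_cases h : j = i
    · subst h; simp
    · simp [Pi.single_eq_of_ne h]
  have hv : (Submodule.Quotient.mk v : CokerN r N₀) = ∑ i, v i • toCokerN r N₀ (Pi.single i 1) := by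
    conv_lhs => rw [← Finset.univ_sum_single v]
    rw [← Submodule.mkQ_apply, map_sum]
    refine Finset.sum_congr rfl fun i _ => ?_
    rw [Submodule.mkQ_apply, toCokerN_single, ← mk_smul_cokerN, hsingle]
  rw [hv]
  exact Submodule.sum_mem _ fun i _ => smul_mem_range r N₀ (v i) ⟨Pi.single i 1, rfl⟩

/-- `ψ_N · (constants)`: `(ψ_N a)_i = Σ_{j ≤ r} ((N₀^j a)_i) z^{r−j}`. [OURS · L1 w44b] -/
theorem psiN_mulVec_C (a : Fin k → A) :
    psiN (X : A[X]) r (N₀.map C) *ᵥ (fun i => C (a i)) =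
      fun i => ∑ j ∈ Finset.range (r + 1), monomial (r - j) ((N₀ ^ j *ᵥ a) i) := by
  rw [psiN, Matrix.sum_mulVec]
  funext i
  rw [Finset.sum_apply]
  refine Finset.sum_congr rfl fun j _ => ?_
  rw [Matrix.smul_mulVec, Pi.smul_apply, ← Matrix.map_pow, smul_eq_mul,
    show (fun i => C (a i)) = (C : A →+* A[X]) ∘ a from rfl, ← RingHom.map_mulVec, mul_comm,
    C_mul_X_pow_eq_monomial]

/-- **`Λ` is injective** when `N₀^{r+1} = 0`: if `[a] = 0`, i.e. `a = φ̄ w`, then `ψ̄ a = ψ̄ φ̄ w = z^{r+1} w = 0`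
in `T_r^k`, and the `z^r`-coefficient of `(ψ a)_i` is `a_i`. [OURS · L1 w44b] -/
theorem toCokerN_injective (hN : N₀ ^ (r + 1) = 0) : Function.Injective (toCokerN r N₀) := by
  refine (injective_iff_map_eq_zero _).mpr fun a ha => ?_
  rw [toCokerN_apply, Submodule.Quotient.mk_eq_zero, LinearMap.mem_range] at ha
  obtain ⟨w, hw⟩ := ha
  rw [Matrix.mulVecLin_apply] at hw
  have hNC : (N₀.map C : Matrix (Fin k) (Fin k) A[X]) ^ (r + 1) = 0 := by
    rw [← Matrix.map_pow, hN]
    exact Matrix.map_zero _ (map_zero _)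
  have h0 : ((psiN (X : A[X]) r (N₀.map C)).map (red A r)) *ᵥ
      (fun i => algebraMap A (Tr A r) (a i)) = 0 := by
    rw [← hw, Matrix.mulVec_mulVec, ← Matrix.map_mul, psiN_mul_phiN (X : A[X]) r _ hNC,
      map_mk_smul_self, Matrix.zero_mulVec]
  have hιa : (fun i => algebraMap A (Tr A r) (a i)) = (red A r) ∘ (fun i => C (a i)) :=
    funext fun i => (red_C r (a i)).symm
  rw [hιa] at h0
  funext i
  have hi := congr_fun h0 i
  rw [Pi.zero_apply, ← RingHom.map_mulVec, Ideal.Quotient.eq_zero_iff_mem,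
    Ideal.mem_span_singleton', psiN_mulVec_C] at hi
  obtain ⟨q, hq⟩ := hi
  have hc := congrArg (fun p : A[X] => p.coeff r) hq
  simp only [coeff_mul_X_pow', finsetSum_coeff, coeff_monomial] at hc
  rw [if_neg (by omega), Finset.sum_eq_single 0 (fun j hj hj0 => if_neg (by
      have := Finset.mem_range.mp hj; omega)) (by simp)] at hc
  simpa using hc.symm

/-- **THE BRIDGE (OURS · w44b (ζ)(i)).**  For `N₀^{r+1} = 0`, `Λ : A^k ≃ coker (φ̄_N : T_r^k → T_r^k)` is
an `A`-linear isomorphism under which `z̄` acts as `N₀` (`red_X_smul_toCokerN`): the MF-module of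
`(z•1 − N, Σ z^{r−j} N^j)` IS the lattice `(A^k, N₀)`. [OURS · L1 w44b] -/
def toCokerNEquiv (hN : N₀ ^ (r + 1) = 0) : (Fin k → A) ≃ₗ[A] CokerN r N₀ :=
  LinearEquiv.ofBijective (toCokerN r N₀) ⟨toCokerN_injective r N₀ hN, toCokerN_surjective r N₀⟩

/-- The lattice basis `[e_0], …, [e_{k-1}]` of `coker φ̄_N` over `A`. [OURS · L1 w44b] -/
def cokerBasis (hN : N₀ ^ (r + 1) = 0) : Module.Basis (Fin k) A (CokerN r N₀) :=
  (Pi.basisFun A (Fin k)).map (toCokerNEquiv r N₀ hN)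

/-- `cokerBasis i = Λ e_i = [e_i]`. [OURS · L1 w44b] -/
theorem cokerBasis_apply (hN : N₀ ^ (r + 1) = 0) (i : Fin k) :
    cokerBasis r N₀ hN i = toCokerN r N₀ (Pi.single i 1) := by
  simp [cokerBasis, toCokerNEquiv]

/-- In the basis, `z̄ [e_i] = [N₀ e_i] = Λ (column i of N₀)`. [OURS · L1 w44b] -/
theorem red_X_smul_cokerBasis (hN : N₀ ^ (r + 1) = 0) (i : Fin k) :
    red A r X • cokerBasis r N₀ hN i = toCokerN r N₀ (N₀ *ᵥ Pi.single i 1) := by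
  rw [cokerBasis_apply, red_X_smul_toCokerN]

end Bridge

/-! ## §4 NO CERTIFICATE for `z^a t^{c₀}` over `(φ_N, ψ_N)`, `N = t^γ J_k` (U7a + U14 through the bridge) -/

section NoCertificate

variable (A : Type u) [CommRing A] (r : ℕ)

/-- The power basis `1, z̄, …, z̄^r` of `T_r = A[z]/(z^{r+1})` over `A` (Mathlib's `AdjoinRoot.powerBasis'`
read on the quotient). [folklore] -/
def pbTr : PowerBasis A (Tr A r) :=
  AdjoinRoot.powerBasis' (g := (X : A[X]) ^ (r + 1)) (monic_X_pow (r + 1))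

/-- Its generator is `z̄`. [folklore] -/
theorem pbTr_gen : (pbTr A r).gen = red A r X := rfl

/-- Its dimension is `r + 1`. [folklore] -/
theorem pbTr_dim [Nontrivial A] : (pbTr A r).dim = r + 1 := by
  simp [pbTr, Polynomial.natDegree_X_pow]

/-- `z̄^{r+1} = 0`: the generator is nilpotent of index `dim` (U14's `hnil`). [folklore] -/
theorem pbTr_gen_pow_dim [Nontrivial A] : (pbTr A r).gen ^ (pbTr A r).dim = 0 := by
  rw [pbTr_gen, pbTr_dim, ← map_pow, Ideal.Quotient.eq_zero_iff_mem]
  exact Ideal.mem_span_singleton_self _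

variable {A}

/-- `(t^γ J_k)^{r+1} = 0` read in `A[z]`, for `k ≤ r + 1`. [folklore] -/
theorem map_C_smul_shiftMatrix_pow_eq_zero (s : A) {k : ℕ} (hk : k ≤ r + 1) :
    ((s • shiftMatrix A k).map C : Matrix (Fin k) (Fin k) A[X]) ^ (r + 1) = 0 := by
  rw [← Matrix.map_pow, smul_shiftMatrix_pow_eq_zero s k (r + 1) hk]
  exact Matrix.map_zero _ (map_zero _)

/-- **`z^a t^{c₀}` does NOT stably annihilate `coker φ̄_N`, `N = t^γ J_k`** (`A` a domain, `t ≠ 0` a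
non-unit, `k ≤ r + 1`, `a < k`, `γ a + c₀ < γ r`): res-D-pv-058's COROLLARY 1
(`not_stablyAnnihilates_of_basis_of_lt`, U14) on the lattice basis `cokerBasis` of §3.
[OURS · L1 w44b · U12-SPEC §6] -/
theorem not_stablyAnnihilates_cokerN [IsDomain A] (t : A) (ht0 : t ≠ 0) (htu : ¬ IsUnit t) (γ : ℕ)
    {k : ℕ} (hk : k ≤ r + 1) (a c₀ : ℕ) (hak : a < k) (hlt : γ * a + c₀ < γ * r) :
    ¬ StablyAnnihilates (Tr A r) (red A r (X ^ a * C (t ^ c₀)))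
      (ModuleCat.of (Tr A r) (CokerN r (t ^ γ • shiftMatrix A k))) := by
  have hN : (t ^ γ • shiftMatrix A k) ^ (r + 1) = 0 :=
    smul_shiftMatrix_pow_eq_zero _ k (r + 1) hk
  have h := not_stablyAnnihilates_of_basis_of_lt (pbTr A r) (M := CokerN r (t ^ γ • shiftMatrix A k))
    (pbTr_gen_pow_dim A r) t ht0 htu γ (cokerBasis r _ hN) ?_ ?_ a c₀ hak
    (by rw [pbTr_dim, Nat.add_sub_cancel]; exact hlt)
  · rwa [pbTr_gen, ← red_C, ← map_pow, ← map_mul] at h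
  · intro h
    rw [pbTr_gen, red_X_smul_cokerBasis, smul_shiftMatrix_mulVec_single_zero, map_zero]
  · intro i h
    rw [pbTr_gen, red_X_smul_cokerBasis, smul_shiftMatrix_mulVec_single_succ, map_smul, cokerBasis_apply]

/-- **NO CERTIFICATE (OURS · w44b (ζ)(ii)).**  With `N = t^γ J_k` read in `A[z]` (`A` a domain, `t ≠ 0` a
non-unit, `k ≤ r + 1`, `a < k`, `γ a + c₀ < γ r`), the equation
`(z^a t^{c₀}) • 1 = G ψ_N + φ_N E` has NO solution `G, E ∈ Mat_k(A[z])`: a solution would make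
`z^a t^{c₀}` stably annihilate `coker φ̄_N` (res-D-pv-058's U7a `stablyAnnihilates_coker_of_eq`),
contradicting `not_stablyAnnihilates_cokerN`. [OURS · L1 w44b] -/
theorem not_exists_certificate [IsDomain A] (t : A) (ht0 : t ≠ 0) (htu : ¬ IsUnit t) (γ : ℕ)
    {k : ℕ} (hk : k ≤ r + 1) (a c₀ : ℕ) (hak : a < k) (hlt : γ * a + c₀ < γ * r) :
    ¬ ∃ G E : Matrix (Fin k) (Fin k) A[X],
      (X ^ a * C (t ^ c₀)) • (1 : Matrix (Fin k) (Fin k) A[X]) =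
        G * psiN X r ((t ^ γ • shiftMatrix A k).map C) + phiN X ((t ^ γ • shiftMatrix A k).map C) * E := by
  rintro ⟨G, E, hGE⟩
  refine not_stablyAnnihilates_cokerN r t ht0 htu γ hk a c₀ hak hlt ?_
  exact stablyAnnihilates_coker_of_eq (X ^ (r + 1)) _ _ G E 0
    (psiN_mul_phiN X r _ (map_C_smul_shiftMatrix_pow_eq_zero r (t ^ γ) hk)) _
    (by rw [smul_zero, add_zero]; exact hGE)

end NoCertificate

end Summit.ResolutionOfSingularities.ResolutionOfSingularities.Theorems.HomologicalConductor.LossAr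

end
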